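import Literature.MathematicalPhysics.QuantumFieldTheory.Balaban1983to89.B8Eq191FlatLettersCubeMember
import Literature.MathematicalPhysics.QuantumFieldTheory.Balaban1983to89.B8DentedCubeMemberZd

/-!
# `Balaban1983to89.B8Eq191FlatLettersDentedCubeMember` — [Balaban1985RegularSpaces] Prop. 6 p. 99 ∕ (1.91) p. 91 ∕ [Balaban1985Variational] (148)–(151) p. 301: the seven flat
# [4]-letters of `B8Eq191FlatLettersDirichlet.exists_flatLetters_dirichlet` AT THE DENTED CUBE MEMBER `{Ω′_j}` (`Ω₀ := c.sq 0 = □₀`, truncated structure `Λs := c.lamST m`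
# of `B8DentedCubeMemberZd`) — finiteness and the TOWER GEOMETRY of the dented cells PROVED, so the letters exist there with NO displayed geometric hypothesis
# (twin of `B8Eq191FlatLettersCubeMember` for NODE 00's dented datum `CubeB8D`; (d3) MAP item (1))

statement-level skeleton of published theorems with citation tags; proofs where landed; nothing here is a claim about the
Yang–Mills mass gap

`[Balaban1985RegularSpaces]` ("B8" = [6], CMP **99** (1985) 75–102) (1.5)–(1.6) p. 77, (1.68) p. 88, (1.91) p. 91, p. 98, (1.131) p. 99, Prop. 6 p. 99; `[Balaban1985Variational]`
("[15]", CMP **102** (1985) 277–309) (148)–(151) p. 301 («H′_k is the operator defined by (46) in [14], but for the sequence {Ω′_j} instead of {Ω_j}»); [4] =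
`[Balaban1985BackgroundPropagators]` Thm 3.1 p. 397, (3.25) p. 394; [B6] = `[Balaban1984PropagatorsII]` p. 235.  PDF held: `paper:balaban1985-cmp99-regular-spaces-gauge-fixing`,
`paper:balaban1985-cmp102-variational-background` (pp. 24–25).

CITATION HEADER (lean-in-tree rule).  Cell `pub-ymgap` (D-0062), DAG node N05 = [B8], seat `pub-ymgap-dag-n05-e` (g31; FAN-OUT §N05 row s3b, (β) road; dag-n05-c standing GO on dented
twins I.42366).  WHY THIS FILE.  The flat line's Prop.-5 servers (`B8SockHFP59Gamma.sockHFP_body_of_join_59_γ`, this seat) consume the seven flat [4]-letters `g Δ q qs Aw c H′`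
with their twelve algebraic laws at the datum's `(Ω₀, Λs)`; `B8Eq191FlatLettersCubeMember.exists_flatLetters_cubeMember` (this seat g3) supplies them at the PURE cube member
by proving the generic construction's three geometric inputs (finiteness; every tower block meets `□₀`; tower blocks over distinct cells are disjoint).  [15] p. 301 uses
the same letters «for the sequence {Ω′_j} instead of {Ω_j}».  THIS FILE proves the three inputs for the DENTED cells `c.lamST m` of NODE 00's `CubeB8D` (p655171 ∕
`B8DentedCubeMemberZd`) and instantiates the letters there.  Below the top truncation the cells are the pure member's (`lamST_of_lt`); at `m = k` the one new step is
the disjointness of a tower over an ENLARGED level-`(k−1)` cell (a dent label) from the towers over the level-`k` cells: a common fine site would lie in `□_k ∩ Ω_k`, and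
`□_k`, `Ω_k` being `Lᵏ`- hence `L^{k−1}`-block saturated (`CubeB8D.blocks`), the dent label's block would be a block of `□_k ∩ Ω_k` — excluded by the cell's definition.

WHAT THIS MODULE PROVES (kernel, 0 sorry; `c : Node00.CubeB8D d L K Ω`, `1 ≤ L`, `m ≤ k`).
§1 `lamS_finite ∕ lamST_finite ∕ sq_zero_finite ∕ sq_antitone ∕ sq_subset_zero`; `not_under_succ_of_mem_cubeLam` (the pure exclusion step, isolated: a site under `y ∈ Λ_j` is not in `□_{j+1}`, `j < k`);
   `under_top_of_under_pred` (a site under a level-`(k−1)` label is under that label's level-`k` parent); ★ `not_under_top_of_mem_lamS_pred` (THE DENT STEP: a site under a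
   level-`(k−1)` dented cell is not in `Ω′_k = □_k ∩ Ω_k`); `tower_meets_dented` (`hmeet`); ★ `towers_disjoint_dented` (`hdisj`).
§2 ★★ `exists_flatLetters_dentedMember`: the seven letters with the twelve algebraic laws at `(c.sq 0, c.lamST m)`, hypotheses `0 < d`, `η ≠ 0`, `1 ≤ L`, `m ≤ k`, weights `≥ 0`
   ONLY (= `exists_flatLetters_dirichlet` BY NAME).
HONEST SCOPE.  Lattice bookkeeping + instantiation; NO estimate (the bounds (1.92) ∕ (1.98) ∕ (1.101) at the dented member are the named `GBoundDentedCubeMemberPrinted` road).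
Count-neutral; N05 ∕ N07 NOT discharged; one finite `T⁴` programme at fixed `ε`, Bałaban as printed; nothing continuum ∕ ℝ⁴ ∕ OS ∕ mass-gap ∕ Clay.  No `sorry`, no `def`, no
`instance`, no `notation`.  Unit `pub-ymgap-dag-n05-e` (g31), 2026-08-28.

RELATED IN THE TREE, NOT DUPLICATED: `B8Eq191FlatLettersCubeMember.{exists_flatLetters_cubeMember, tower_meets_cube, towers_disjoint_cube, inBox_finite, cubeLamS_finite,
under_iff_blockMap_eq, flm_one_flm, under_smul_self, blockMap_pow_eq_flm}` (this seat g3; PURE member — USED), `B8Eq191FlatLettersDirichlet.exists_flatLetters_dirichlet` (generic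
construction — USED BY NAME), `B8DentedCubeMemberZd.{lamST, lamST_of_lt, lamST_top, inBox_sq_of_mem_lamS, inBox_sq_of_mem_lamST, htower_lamS}` (g31), `Node00.CarriersB8CubeDented`.
-/

noncomputable section

namespace Literature.MathematicalPhysics.QuantumFieldTheory.Balaban1983to89.B8Eq191FlatLettersDentedCubeMember

open B7Prop1Explicit (e)
open B7Prop1Local (InBox)
open B7Eq78Linearization (QprimeIter zdBlocking)
open B8Ineq132 (Under)
open B8Eq119TwistedAxial (bgT)
open B8Eq138LandauZd (covLap QT)
open B8Eq1117Concrete (XSpace)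
open B8Eq131Cubes (cube sqLo sqHi inLo inHi flm under_flm mem_cube_iff cube_anti)
open B8Eq131CubesAdmissible (cubeFam cubeFam_false_of_le cubeFam_false_zero smul_mem_cube_iff smul_mem_cube_succ_iff)
open B8CubeMemberZd (cubeLam cubeLamS cubeLamS_of_lt cubeLamS_top inBox_sq_of_mem_cubeLamS inBox_tower_iff_under)
open B8Ineq166Univ (under_add_of_under)
open Literature.MathematicalPhysics.QuantumLattice (blockMap)
open B8Eq191FlatLettersDirichlet (exists_flatLetters_dirichlet)
open B8Eq191FlatLettersCubeMember (inBox_finite cubeLamS_finite tower_meets_cube towers_disjoint_cube under_iff_blockMap_eq flm_one_flm under_smul_self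
  blockMap_pow_eq_flm)
open B8DentedCubeMemberZd (lamST_of_lt lamST_top inBox_sq_of_mem_lamS inBox_sq_of_mem_lamST htower_lamS)
open Node00 (CubeB8D)

variable {d : ℕ}

/-! ## §1 Finiteness and the tower geometry of the dented member -/

section Geometry

variable {L K : ℕ} {Ω : ℕ → Set (Fin d → ℤ)} (c : CubeB8D d L K Ω)

/-- The dented cells are finite (they lie in `□_j^{(j)}`). [cite: Balaban1985Variational, (148) p.301; Balaban1985RegularSpaces, (1.131) p.99] -/
theorem lamS_finite (j : ℕ) : (c.lamS j).Finite :=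
  (inBox_finite (sqLo L c.a c.ρ c.k j) (sqHi L c.a c.M c.ρ c.k j)).subset fun _ hz => inBox_sq_of_mem_lamS c hz

/-- The truncated dented cells are finite. [cite: Balaban1985RegularSpaces, (1.68) p.88; Balaban1985Variational, (148) p.301] -/
theorem lamST_finite (m j : ℕ) : (c.lamST m j).Finite :=
  (inBox_finite (sqLo L c.a c.ρ c.k j) (sqHi L c.a c.M c.ρ c.k j)).subset fun _ hz => inBox_sq_of_mem_lamST c hz

/-- `Ω′₀ = □₀` is finite. [cite: Balaban1985RegularSpaces, p.98; Balaban1985Variational, (150) p.301] -/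
theorem sq_zero_finite : (c.sq 0).Finite := by
  rw [c.sq_zero]; exact inBox_finite _ _

/-- `Ω′_b ⊆ Ω′_a` for `a ≤ b` (iterated (1.3) on the dented tower). [cite: Balaban1985RegularSpaces, (1.3) p.77; Balaban1985Variational, (150) p.301] -/
theorem sq_antitone {a b : ℕ} (hab : a ≤ b) : c.sq b ⊆ c.sq a := by
  induction hab with
  | refl => exact subset_rfl
  | step _ ih => exact (c.sq_succ_subset _).trans ih

/-- `Ω′_j ⊆ Ω′₀ = □₀` — the `hsub` binder of the flat-letters consumers (`flatLettersRD_of_real`). [cite: Balaban1985RegularSpaces, (1.3) p.77; Balaban1985Variational, (150) p.301] -/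
theorem sq_subset_zero : ∀ j, c.sq j ⊆ c.sq 0 := fun j => sq_antitone c (Nat.zero_le j)

/-- **THE PURE EXCLUSION STEP, ISOLATED**: a fine site `z` under a pure cell `y ∈ Λ_j = □_j^{(j)} ∖ □_{j+1}^{(j)}` (`j < k`) does NOT lie in `□_{j+1}` — `□_{j+1}` is a union of
`L^{j+1}`-, hence of `Lʲ`-blocks, so it would contain the corner `Lʲ•y`, i.e. `y ∈ □_{j+1}^{(j)}`. [cite: Balaban1985RegularSpaces, (1.5)–(1.6) p.77, p.98, (1.131) p.99] -/
theorem not_under_succ_of_mem_cubeLam (hL : 1 ≤ L) {j : ℕ} (hjk : j < c.k) {y z : Fin d → ℤ} (hy : y ∈ cubeLam L c.a c.M c.ρ c.k j)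
    (hz : Under L j y z) (hz2 : z ∈ cube L c.a c.M c.ρ c.k (j + 1)) : False := by
  obtain ⟨w, hw, hwz⟩ := (mem_cube_iff hL).mp hz2
  have hyz : flm L j z = y := by
    rw [← blockMap_pow_eq_flm]; exact (under_iff_blockMap_eq hL j y z).mp hz
  have hwz' : flm L (j + 1) z = w := by
    rw [← blockMap_pow_eq_flm]; exact (under_iff_blockMap_eq hL (j + 1) w z).mp hwz
  have hwy : Under L 1 w y := by
    have h := under_flm hL 1 y
    rwa [← hyz, flm_one_flm, hwz', hyz] at h
  have hcorner : Under L (j + 1) w (((L : ℤ) ^ j) • y) := by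
    have h := under_add_of_under hwy (under_smul_self hL j y)
    rwa [Nat.add_comm] at h
  have hin : ((L : ℤ) ^ j) • y ∈ cube L c.a c.M c.ρ c.k (j + 1) := (mem_cube_iff hL).mpr ⟨w, hw, hcorner⟩
  exact hy.2 hjk ((smul_mem_cube_succ_iff hL c.a c.M c.ρ hjk y).mp hin)

/-- A site under a level-`(k−1)` label `y` lies under `y`'s level-`k` parent `⌊y∕L⌋` (blocks nest). [cite: Balaban1985RegularSpaces, (1.6) p.77] -/
theorem under_top_of_under_pred (hL : 1 ≤ L) {y z : Fin d → ℤ} (hz : Under L (c.k - 1) y z) : Under L c.k (flm L 1 y) z := by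
  have hk := c.one_le_k
  have h := under_add_of_under (under_flm hL 1 y) hz
  rwa [show 1 + (c.k - 1) = c.k by omega] at h

/-- ★ **THE DENT STEP**: a fine site `z` under a level-`(k−1)` DENTED cell `y ∈ Λ′_{k−1}` does NOT lie in `Ω′_k = □_k ∩ Ω_k` — otherwise every site under `y` would lie in `□_k`
(the `L^{k−1}`-block under `y` sits inside the `Lᵏ`-block of `z`, a block of `□_k`) and in `Ω_k` (`Lᵏ`-block saturation, `CubeB8D.blocks`), making `y`'s block a block of
`□_k ∩ Ω_k`, which the definition of `Λ′_{k−1}` excludes. [cite: Balaban1985Variational, (148)–(150) p.301; Balaban1985RegularSpaces, (1.3)–(1.6) p.77, p.98] -/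
theorem not_under_top_of_mem_lamS_pred (hL : 1 ≤ L) {y z : Fin d → ℤ} (hy : y ∈ c.lamS (c.k - 1)) (hz : Under L (c.k - 1) y z)
    (hzk : z ∈ c.sq c.k) : False := by
  have hk := c.one_le_k
  rw [c.sq_top] at hzk
  obtain ⟨hzc, hzΩ⟩ := hzk
  rw [c.mem_lamS_pred_iff] at hy
  obtain ⟨-, hnd⟩ := hy
  apply hnd
  -- the `k`-parent `w = ⌊y∕L⌋` of `y` is the `k`-label of `z`, a site of `□_k^{(k)}`
  have hUz : Under L c.k (flm L 1 y) z := under_top_of_under_pred c hL hz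
  have hwz : flm L c.k z = flm L 1 y := by
    rw [← blockMap_pow_eq_flm]; exact (under_iff_blockMap_eq hL c.k _ z).mp hUz
  obtain ⟨w, hw, hwU⟩ := (mem_cube_iff hL).mp hzc
  have hww : flm L 1 y = w := by
    rw [← hwz, ← blockMap_pow_eq_flm]; exact (under_iff_blockMap_eq hL c.k w z).mp hwU
  -- every site under `y` is under `w`, hence in `□_k` and (block law) in `Ω_k`
  have hall : ∀ x, Under L (c.k - 1) y x → x ∈ cube L c.a c.M c.ρ c.k c.k ∧ x ∈ Ω c.k := by
    intro x hx
    have hUx : Under L c.k (flm L 1 y) x := under_top_of_under_pred c hL hx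
    refine ⟨(mem_cube_iff hL).mpr ⟨w, hw, by rw [← hww]; exact hUx⟩, c.blocks ?_ hzΩ⟩
    rw [blockMap_pow_eq_flm, blockMap_pow_eq_flm, hwz]
    rw [← blockMap_pow_eq_flm]
    exact ((under_iff_blockMap_eq hL c.k _ x).mp hUx).symm
  refine ⟨?_, fun x hx => (hall x hx).2⟩
  -- `y ∈ □_k^{(k−1)}`: its corner `L^{k−1}•y` lies in `□_k`
  have hkk : c.k - 1 < c.k := by omega
  have hcorner := (hall _ (under_smul_self hL (c.k - 1) y)).1
  have h := (smul_mem_cube_succ_iff hL c.a c.M c.ρ hkk y).mp (by rw [show c.k - 1 + 1 = c.k by omega]; exact hcorner)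
  exact h

/-- **`hmeet` at the dented member**: every tower over a dented cell meets `Ω′₀ = □₀` — the corner `Lʲ•y` of `Bʲ(y)`, `y ∈ c.lamST m j ⊂ □_j^{(j)}`, lies in `□_j ⊂ □₀`.
[cite: Balaban1985RegularSpaces, (1.5)–(1.6) p.77, p.98; Balaban1985Variational, (148)–(150) p.301] -/
theorem tower_meets_dented (hL : 1 ≤ L) {m : ℕ} (hm : m ≤ c.k) :
    ∀ j, j ≤ m → ∀ y ∈ c.lamST m j, ∃ z ∈ c.sq 0, blockMap (L ^ j) z = y := by
  intro j hj y hy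
  refine ⟨((L : ℤ) ^ j) • y, ?_, (under_iff_blockMap_eq hL j y _).mp (under_smul_self hL j y)⟩
  have h1 : ((L : ℤ) ^ j) • y ∈ cube L c.a c.M c.ρ c.k j := (smul_mem_cube_iff hL c.a c.M c.ρ c.k j y).mpr (inBox_sq_of_mem_lamST c hy)
  rw [c.sq_zero]
  exact cube_anti (Nat.zero_le j) (hj.trans hm) h1

/-- ★ **`hdisj` at the dented member**: the tower blocks over `𝔅′_m = {(j, y) ∣ j ≤ m, y ∈ c.lamST m j}` are pairwise disjoint.  Below the top the pure law; at the top: a common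
fine site under `y ∈ Λ′_j` and `y′ ∈ Λ′_{j′}`, `j < j′`, lies in `Ω′_{j′} ⊆ Ω′_{j+1}` (`htower`), which is excluded by the pure step (`Λ′_j = Λ_j`, `j ≤ k − 2`, or `j = k − 1`
with `j′ = k` read through `□_k`) resp. by the dent step (`j = k − 1`, `j′ = k`). [cite: Balaban1985RegularSpaces, (1.5)–(1.6) p.77 («𝔅_k = ⋃_j Λ_j»), (1.131) p.99; Balaban1985Variational, (148)–(150) p.301] -/
theorem towers_disjoint_dented (hL : 1 ≤ L) {m : ℕ} (hm : m ≤ c.k) :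
    ∀ j, j ≤ m → ∀ j', j' ≤ m → ∀ y ∈ c.lamST m j, ∀ y' ∈ c.lamST m j', ∀ z ∈ c.sq 0,
      blockMap (L ^ j) z = y → blockMap (L ^ j') z = y' → j = j' ∧ y = y' := by
  have hk := c.one_le_k
  have hρ : L ≤ c.ρ := c.L_le_ρ
  rcases lt_or_eq_of_le hm with hlt | heq
  · -- below the top: the pure member's law verbatim
    intro j hj j' hj' y hy y' hy' z hz h1 h2
    rw [lamST_of_lt c hlt] at hy hy'
    rw [c.sq_zero, ← cubeFam_false_zero L c.a c.M c.ρ c.k] at hz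
    exact towers_disjoint_cube hL c.a c.M hρ hm j hj j' hj' y hy y' hy' z hz h1 h2
  · subst heq
    -- the asymmetric core: no common site under `y ∈ Λ′_j`, `y′ ∈ Λ′_{j′}` with `j < j′ ≤ k`
    have core : ∀ {j j' : ℕ}, j < j' → j' ≤ c.k → ∀ {y y' z : Fin d → ℤ}, y ∈ c.lamS j → y' ∈ c.lamS j' →
        Under L j y z → Under L j' y' z → False := by
      intro j j' hjj hj' y y' z hy hy' hz hz'
      -- `z ∈ Ω′_{j′} ⊆ Ω′_{j+1}`
      have hzj' : z ∈ c.sq j' := htower_lamS c hL j' hj' y' (by rw [lamST_top c]; exact hy') z ((inBox_tower_iff_under L j' y' z).2 hz')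
      have hzj1 : z ∈ c.sq (j + 1) := sq_antitone c (Nat.succ_le_of_lt hjj) hzj'
      rcases Nat.lt_or_ge (j + 1) c.k with hll | hge
      · -- `j ≤ k − 2`: `Λ′_j = Λ_j`, `Ω′_{j+1} = □_{j+1}`
        rw [c.lamS_of_succ_lt hll] at hy
        rw [c.sq_of_lt hll] at hzj1
        exact not_under_succ_of_mem_cubeLam c hL (by omega) hy hz hzj1
      · -- `j = k − 1`, `j′ = k`: the dent step
        have hj : j = c.k - 1 := by omega
        have hjk : j + 1 = c.k := by omega
        subst hj
        rw [hjk] at hzj1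
        exact not_under_top_of_mem_lamS_pred c hL hy hz hzj1
    intro j hj j' hj' y hy y' hy' z _ h1 h2
    rw [lamST_top c] at hy hy'
    have hz1 : Under L j y z := (under_iff_blockMap_eq hL j y z).mpr h1
    have hz2 : Under L j' y' z := (under_iff_blockMap_eq hL j' y' z).mpr h2
    rcases lt_trichotomy j j' with hlt | heq | hgt
    · exact absurd (core hlt hj' hy hy' hz1 hz2) id
    · subst heq; exact ⟨rfl, h1.symm.trans h2⟩
    · exact absurd (core hgt hj hy' hy hz2 hz1) id

end Geometry

/-! ## §2 The flat letters at the dented member -/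

section Letters

variable {L K : ℕ} {Ω : ℕ → Set (Fin d → ℤ)}
variable {𝔸 : Type*} [CStarAlgebra 𝔸]

/-- ★★ **THE SEVEN FLAT [4]-LETTERS AT THE DENTED CUBE MEMBER `{Ω′_j}` OF [15] (148)–(150)** (Proposition 6's datum `(1, U₀″)` on the local sequence, p. 301 «for the sequence
{Ω′_j} instead of {Ω_j}»): for `0 < d`, `η ≠ 0`, `1 ≤ L`, `m ≤ k`, weights `w_j ≥ 0`, the letters `g Δ q qs Aw c H′` of `B8Eq191FlatLettersDirichlet.exists_flatLetters_dirichlet` exist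
for `Ω₀ := Ω′₀ = c.sq 0 = □₀` and the truncated structure `Λs := c.lamST m`, with the twelve algebraic laws of the per-datum JOIN at `U₀ := 1` — NO geometric hypothesis displayed
(finiteness, `hmeet`, `hdisj` are §1).
[cite: Balaban1985Variational, (148)–(151) p.301; Balaban1985RegularSpaces, Prop. 6 p.99, (1.131) p.99, (1.91) p.91, (1.95) p.92; Balaban1985BackgroundPropagators, Thm 3.1 p.397, (3.25) p.394; Balaban1984PropagatorsII, p.235] -/
theorem exists_flatLetters_dentedMember (hd : 0 < d) {η : ℝ} (hη : η ≠ 0) (hL : 1 ≤ L) (c : CubeB8D d L K Ω)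
    {m : ℕ} (hm : m ≤ c.k) (w : ℕ → ℝ) (hw : ∀ j, 0 ≤ w j) :
    ∃ (g Δ : ((Fin d → ℤ) → 𝔸) →ₗ[ℂ] ((Fin d → ℤ) → 𝔸)) (q : ((Fin d → ℤ) → 𝔸) →ₗ[ℂ] (ℕ → (Fin d → ℤ) → 𝔸))
      (qs : (ℕ → (Fin d → ℤ) → 𝔸) →ₗ[ℂ] ((Fin d → ℤ) → 𝔸)) (Aw c' : (ℕ → (Fin d → ℤ) → 𝔸) →ₗ[ℂ] (ℕ → (Fin d → ℤ) → 𝔸))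
      (H' : XSpace d m 𝔸 →ₗ[ℂ] ((Fin d → ℤ) → 𝔸)),
      (∀ x, ∀ y ∈ c.sq 0, (Δ (g x) + qs (Aw (q (g x)))) y = x y) ∧
      (∀ f, q (g (g (qs (c' (q f))))) = q f) ∧
      (∀ f, ∀ x ∈ c.sq 0, Δ f x = covLap η (1 : (Fin d → ℤ) → Fin d → 𝔸ˣ) ((c.sq 0).indicator f) x) ∧
      (∀ μ, ∀ x ∈ c.sq 0, qs μ x = QT L m (c.lamST m) (1 : (Fin d → ℤ) → Fin d → 𝔸ˣ) μ x) ∧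
      (∀ f j, j ≤ m → ∀ y ∈ c.lamST m j,
        q f j y = QprimeIter (zdBlocking d L) (bgT L (1 : (Fin d → ℤ) → Fin d → 𝔸ˣ)) j f y) ∧
      (∀ μ j y, Aw μ j y = w j • μ j y) ∧
      (∀ (X : XSpace d m 𝔸) (x : Fin d → ℤ), x ∉ c.sq 0 → H' X x = 0) ∧
      (∀ X Y : XSpace d m 𝔸, (∀ p, Y p = -star (X p)) → ∀ x, H' Y x = -star (H' X x)) ∧
      (∀ (Y : XSpace d m 𝔸) (j : ℕ) (hj : j ≤ m) (y : Fin d → ℤ), y ∈ c.lamST m j →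
        QprimeIter (zdBlocking d L) (bgT L (1 : (Fin d → ℤ) → Fin d → 𝔸ˣ)) j (H' Y) y = Y (⟨j, Nat.lt_succ_of_le hj⟩, y)) ∧
      (∀ f x, x ∉ c.sq 0 → g f x = 0) ∧
      (∀ f, (∀ x ∈ c.sq 0, IsSelfAdjoint (f x)) → ∀ x, IsSelfAdjoint (g f x)) ∧
      (∀ f, (∀ x ∈ c.sq 0, IsSelfAdjoint (f x)) → ∀ x, IsSelfAdjoint (g (qs (c' (q (g f)))) x)) :=
  exists_flatLetters_dirichlet hd hη hL m (c.lamST m) (fun j _ => lamST_finite c m j) w hw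
    (c.sq 0) (sq_zero_finite c) (tower_meets_dented c hL hm) (towers_disjoint_dented c hL hm)

end Letters

end Literature.MathematicalPhysics.QuantumFieldTheory.Balaban1983to89.B8Eq191FlatLettersDentedCubeMember

end
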